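import Summits.QuantumFields.YangMills.Theorems.OneCertifiedCubeCrossoverCertificateDefs
import Literature.MathematicalPhysics.QuantumLattice.WilsonLoops

/-!
# Lattice non-abelian Stokes bound: a conjugation-invariant subadditive function of a rectangular Wilson loop
# is at most its sum over the enclosed plaquettes
(helper file for the frozen-coupling analysis of crux `CrossoverCertificate`, stmt-QuantumFields-16125)

Pure group algebra on `ℤ^d` (no measure theory): for a configuration `U : LGConfig d G` and the
rectangular walk `rectWalk x i j R T` of `Literature/…/WilsonLoops.lean` we compute the holonomies
of straight walks (`walkHolonomy_lineWalk_zero/succ/succ'`), express the rectangle holonomy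
through them (`walkHolonomy_rectWalk`), identify the unit square with the plaquette holonomy
(`walkHolonomy_rectWalk_one_one`), and prove the two lattice Stokes recursions: adding a
plaquette on top of a `1 × T` column (`walkHolonomy_rectWalk_one_succ`) and adding a column to
an `R × T` rectangle (`walkHolonomy_rectWalk_succ`), each new piece entering conjugated by a
"tail" holonomy.  Consequently every conjugation-invariant subadditive `θ : G → ℝ` with
`θ 1 ≤ 0` (e.g. a bi-invariant word length, or the geodesic distance to `1` in a compact Lie
group) satisfies `θ (hol (rectWalk x i j R T)) ≤ ∑_{s < R} ∑_{t < T} θ (U_{p(x + s eᵢ + t eⱼ)})`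
(`le_sum_plaquettes_of_subadditive`).  No hypothesis `i ≠ j` is needed (for `i = j` both sides
speak about degenerate back-tracking walks and junk plaquettes, and the bound is still true).

References: K. G. Wilson, Phys. Rev. D 10 (1974) 2445 (plaquette decomposition of Wilson
loops); E. Seiler, LNP 159 (1982), Ch. 1.
-/

noncomputable section

namespace Summit.QuantumFields.YangMills.Theorems.CrossoverCertificate.Negative

open Literature.MathematicalPhysics.QuantumLattice Literature.Probability.LatticeModels SimpleGraph

variable {d : ℕ} {G : Type*} [Group G]

/-! ### Holonomies of straight walks -/

/-- The holonomy of the straight walk of length `0` is `1`. [folklore] -/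
theorem walkHolonomy_lineWalk_zero (U : LGConfig d G) (i : Fin d) (x : Site d) :
    walkHolonomy U (lineWalk i 0 x) = 1 := by
  rw [lineWalk, walkHolonomy_copy, walkHolonomy_nil]

/-- First-step recursion: `hol (x → x + (n+1) eᵢ) = U (x, i) · hol (x + eᵢ → x + (n+1) eᵢ)`. [folklore] -/
theorem walkHolonomy_lineWalk_succ (U : LGConfig d G) (i : Fin d) (n : ℕ) (x : Site d) :
    walkHolonomy U (lineWalk i (n + 1) x) =
      U (x, i) * walkHolonomy U (lineWalk i n (x + Pi.single i 1)) := by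
  rw [lineWalk, walkHolonomy_cons, walkHolonomy_copy, dartHolonomy_add_single]

/-- The holonomy of a single forward step is the link variable `U (x, i)`. [folklore] -/
theorem walkHolonomy_lineWalk_one (U : LGConfig d G) (i : Fin d) (x : Site d) :
    walkHolonomy U (lineWalk i 1 x) = U (x, i) := by
  rw [walkHolonomy_lineWalk_succ, walkHolonomy_lineWalk_zero, mul_one]

/-- The holonomy of a straight walk is unchanged under rewriting its base point along an
equality of sites (transport of the dependently typed `lineWalk`). [folklore] -/
theorem walkHolonomy_lineWalk_congr (U : LGConfig d G) (i : Fin d) (n : ℕ) {x y : Site d}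
    (h : x = y) : walkHolonomy U (lineWalk i n x) = walkHolonomy U (lineWalk i n y) := by
  subst h
  rfl

/-- Last-step recursion: `hol (x → x + (n+1) eᵢ) = hol (x → x + n eᵢ) · U (x + n eᵢ, i)`. [folklore] -/
theorem walkHolonomy_lineWalk_succ' (U : LGConfig d G) (i : Fin d) :
    ∀ (n : ℕ) (x : Site d), walkHolonomy U (lineWalk i (n + 1) x) =
      walkHolonomy U (lineWalk i n x) * U (x + Pi.single i (n : ℤ), i)
  | 0, x => by
    rw [walkHolonomy_lineWalk_one, walkHolonomy_lineWalk_zero, one_mul, Nat.cast_zero,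
      Pi.single_zero, add_zero]
  | n + 1, x => by
    have h : x + Pi.single i (1 : ℤ) + Pi.single i (n : ℤ) = x + Pi.single i ((n + 1 : ℕ) : ℤ) := by
      rw [add_assoc, ← Pi.single_add, Nat.cast_succ, add_comm (1 : ℤ)]
    rw [walkHolonomy_lineWalk_succ U i (n + 1) x, walkHolonomy_lineWalk_succ U i n x, ← h,
      walkHolonomy_lineWalk_succ' U i n (x + Pi.single i 1), mul_assoc]

/-! ### The rectangle holonomy and the two Stokes recursions -/

/-- The holonomy of the rectangular walk is
`hol(x → x+Reᵢ) · hol(x+Reᵢ → x+Reᵢ+Teⱼ) · hol(x+Teⱼ → x+Teⱼ+Reᵢ)⁻¹ · hol(x → x+Teⱼ)⁻¹`. [folklore] -/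
theorem walkHolonomy_rectWalk (U : LGConfig d G) (x : Site d) (i j : Fin d) (R T : ℕ) :
    walkHolonomy U (rectWalk x i j R T) =
      walkHolonomy U (lineWalk i R x) * walkHolonomy U (lineWalk j T (x + Pi.single i (R : ℤ))) *
        (walkHolonomy U (lineWalk i R (x + Pi.single j (T : ℤ))))⁻¹ *
          (walkHolonomy U (lineWalk j T x))⁻¹ := by
  simp only [rectWalk, walkHolonomy_append, walkHolonomy_copy, walkHolonomy_reverse, mul_assoc]

/-- The unit square Wilson loop is the plaquette holonomy. [folklore] -/
theorem walkHolonomy_rectWalk_one_one (U : LGConfig d G) (x : Site d) (i j : Fin d) :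
    walkHolonomy U (rectWalk x i j 1 1) = plaquetteHolonomyZd U x i j := by
  rw [walkHolonomy_rectWalk]
  simp only [walkHolonomy_lineWalk_one, Nat.cast_one, plaquetteHolonomyZd]

/-- Lattice Stokes, column step: the `1 × (T+1)` rectangle is the `1 × T` rectangle times the
top plaquette conjugated by the tail `hol(x → x + T eⱼ)`. [folklore] -/
theorem walkHolonomy_rectWalk_one_succ (U : LGConfig d G) (x : Site d) (i j : Fin d) (T : ℕ) :
    walkHolonomy U (rectWalk x i j 1 (T + 1)) =
      walkHolonomy U (rectWalk x i j 1 T) *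
        (walkHolonomy U (lineWalk j T x) * plaquetteHolonomyZd U (x + Pi.single j (T : ℤ)) i j *
          (walkHolonomy U (lineWalk j T x))⁻¹) := by
  have h1 : x + Pi.single i ((1 : ℕ) : ℤ) + Pi.single j (T : ℤ) =
      x + Pi.single j (T : ℤ) + Pi.single i 1 := by
    rw [Nat.cast_one, add_right_comm]
  have h2 : x + Pi.single j ((T + 1 : ℕ) : ℤ) = x + Pi.single j (T : ℤ) + Pi.single j 1 := by
    rw [Nat.cast_succ, Pi.single_add, add_assoc]
  rw [walkHolonomy_rectWalk, walkHolonomy_rectWalk, walkHolonomy_lineWalk_succ' U j T,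
    walkHolonomy_lineWalk_succ' U j T]
  simp only [walkHolonomy_lineWalk_one, h1, h2, plaquetteHolonomyZd]
  group

/-- Lattice Stokes, row step: the `(R+1) × T` rectangle is the `1 × T` column based at
`x + R eᵢ`, conjugated by the tail `hol(x → x + R eᵢ)`, times the `R × T` rectangle. [folklore] -/
theorem walkHolonomy_rectWalk_succ (U : LGConfig d G) (x : Site d) (i j : Fin d) (R T : ℕ) :
    walkHolonomy U (rectWalk x i j (R + 1) T) =
      (walkHolonomy U (lineWalk i R x) *
          walkHolonomy U (rectWalk (x + Pi.single i (R : ℤ)) i j 1 T) *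
            (walkHolonomy U (lineWalk i R x))⁻¹) *
        walkHolonomy U (rectWalk x i j R T) := by
  have h3 : x + Pi.single i ((R + 1 : ℕ) : ℤ) =
      x + Pi.single i (R : ℤ) + Pi.single i ((1 : ℕ) : ℤ) := by
    rw [Nat.cast_succ, Pi.single_add, ← add_assoc, Nat.cast_one]
  have h4 : x + Pi.single j (T : ℤ) + Pi.single i (R : ℤ) =
      x + Pi.single i (R : ℤ) + Pi.single j (T : ℤ) := add_right_comm _ _ _
  rw [walkHolonomy_rectWalk, walkHolonomy_rectWalk, walkHolonomy_rectWalk,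
    walkHolonomy_lineWalk_succ' U i R, walkHolonomy_lineWalk_succ' U i R,
    walkHolonomy_lineWalk_congr U j T h3]
  simp only [walkHolonomy_lineWalk_one, h4]
  group

/-! ### The subadditive Stokes bound -/

/-- One-column Stokes bound: for a conjugation-invariant subadditive `θ` with `θ 1 ≤ 0`,
`θ (hol (1 × T column at x)) ≤ ∑_{t < T} θ (U_{p(x + t eⱼ)})`. [folklore] -/
theorem le_sum_plaquettes_column (θ : G → ℝ) (hconj : ∀ a b : G, θ (b * a * b⁻¹) = θ a)
    (hsub : ∀ a b : G, θ (a * b) ≤ θ a + θ b) (hone : θ 1 ≤ 0) (U : LGConfig d G) (x : Site d)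
    (i j : Fin d) : ∀ T : ℕ,
    θ (walkHolonomy U (rectWalk x i j 1 T)) ≤
      ∑ t ∈ Finset.range T, θ (plaquetteHolonomyZd U (x + Pi.single j (t : ℤ)) i j)
  | 0 => by
    have h : walkHolonomy U (rectWalk x i j 1 0) = 1 := by
      rw [walkHolonomy_rectWalk]
      simp only [walkHolonomy_lineWalk_one, walkHolonomy_lineWalk_zero, Nat.cast_zero,
        Pi.single_zero, add_zero, mul_one, inv_one, mul_inv_cancel]
    rw [Finset.sum_range_zero, h]
    exact hone
  | T + 1 => by
    rw [walkHolonomy_rectWalk_one_succ, Finset.sum_range_succ]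
    exact (hsub _ _).trans
      (add_le_add (le_sum_plaquettes_column θ hconj hsub hone U x i j T) (hconj _ _).le)

/-- **Lattice non-abelian Stokes bound.** For a conjugation-invariant subadditive
`θ : G → ℝ` with `θ 1 ≤ 0` (e.g. a bi-invariant word length, or the geodesic distance to `1`
in a compact Lie group), the value of `θ` on the holonomy of the `R × T` rectangular Wilson
loop based at `x` in the `(i, j)` plane is at most the sum of `θ` over the `R T` enclosed
plaquette holonomies: the loop is a product of the `R T` plaquettes, each conjugated by a
tail (`walkHolonomy_rectWalk_one_succ`, `walkHolonomy_rectWalk_succ`). [folklore] -/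
theorem le_sum_plaquettes_of_subadditive (θ : G → ℝ) (hconj : ∀ a b : G, θ (b * a * b⁻¹) = θ a)
    (hsub : ∀ a b : G, θ (a * b) ≤ θ a + θ b) (hone : θ 1 ≤ 0) (U : LGConfig d G) (x : Site d)
    (i j : Fin d) : ∀ R T : ℕ,
    θ (walkHolonomy U (rectWalk x i j R T)) ≤
      ∑ s ∈ Finset.range R, ∑ t ∈ Finset.range T,
        θ (plaquetteHolonomyZd U (x + Pi.single i (s : ℤ) + Pi.single j (t : ℤ)) i j)
  | 0, T => by
    have h0 : x + Pi.single i ((0 : ℕ) : ℤ) = x := by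
      rw [Nat.cast_zero, Pi.single_zero, add_zero]
    have h : walkHolonomy U (rectWalk x i j 0 T) = 1 := by
      rw [walkHolonomy_rectWalk, walkHolonomy_lineWalk_congr U j T h0]
      simp only [walkHolonomy_lineWalk_zero, one_mul, inv_one, mul_one, mul_inv_cancel]
    rw [Finset.sum_range_zero, h]
    exact hone
  | R + 1, T => by
    rw [walkHolonomy_rectWalk_succ, Finset.sum_range_succ]
    refine (hsub _ _).trans ?_
    rw [hconj]
    exact (add_le_add
      (le_sum_plaquettes_column θ hconj hsub hone U (x + Pi.single i (R : ℤ)) i j T)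
      (le_sum_plaquettes_of_subadditive θ hconj hsub hone U x i j R T)).trans_eq (add_comm _ _)

/-- **Lattice Stokes bound on `ℤ⁴`** (the case consumed by the frozen-coupling analysis; universe-monomorphic
restatement of `le_sum_plaquettes_of_subadditive`, registered as the sub-goal this file serves). [folklore] -/
theorem le_sum_plaquettes_of_subadditive_d4 : ∀ {G : Type} [Group G] (θ : G → ℝ), (∀ a b : G, θ (b * a * b⁻¹) = θ a) → (∀ a b : G, θ (a * b) ≤ θ a + θ b) → θ 1 ≤ 0 → ∀ (U : Literature.MathematicalPhysics.QuantumLattice.LGConfig 4 G) (x : Literature.Probability.LatticeModels.Site 4) (i j : Fin 4) (R T : ℕ), θ (Literature.MathematicalPhysics.QuantumLattice.walkHolonomy U (Literature.MathematicalPhysics.QuantumLattice.rectWalk x i j R T)) ≤ ∑ s ∈ Finset.range R, ∑ t ∈ Finset.range T, θ (Literature.MathematicalPhysics.QuantumLattice.plaquetteHolonomyZd U (x + Pi.single i (s : ℤ) + Pi.single j (t : ℤ)) i j) :=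
  fun θ hconj hsub hone U x i j R T => le_sum_plaquettes_of_subadditive θ hconj hsub hone U x i j R T

end Summit.QuantumFields.YangMills.Theorems.CrossoverCertificate.Negative

end
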